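import Mathlib
import Summits.NavierStokesRegularity.NavierStokesRegularity.Theorems.SubOnsagerCeilingKPDarkShell
import HarnessLib

/-!
# KP networks proper with a DARK SHELL satisfy the primary graded barrier at EVERY scale ratio (helper file
# for crux stmt-NavierStokesRegularity-27057 `SubOnsagerCeiling.ForwardTailCeilingKP`, `--supports`;
# registered stubs `stub_primaryGradedLargeRatio` / `stub_primaryGradedSmallRatio` of the LEAD skeleton
# `Cruxes/ForwardTailCeilingKP/Lines/kp_shell_barrier.lean`; part 2 of 2, part 1 = `…KPDarkShell.lean`)

Part 1 proved: low energies of a KP network proper never increase (`kpProper_half_sq_le_energy`: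
`½X_{i,k}(t)² ≤ E₀`, ν-uniform) and dark modes stay dark along a lit-set certificate
`A : ℕ → Finset (Fin 4)` (`kpProper_dark_zero`).  Here:

* §4 `kpProper_darkShell_barrier` — if the certificate EMPTIES from shell `K` on (a DARK SHELL), every mode
  obeys `(1+ε₀)^{2k}·½X_{i,k}(t)² ≤ ((1+ε₀)²)^K·E₀` along every honest non-negative viscous solution from a
  one-shell datum: the weighted shell barrier with `θ = 1`, `D = (1+ε₀)^{2K}`, uniform in `ν`, datum, window.
* §5 `kpProper_darkShell_primaryGraded` — the conclusion of the LEAD skeleton's `PrimaryGradedAt R ε₀ α`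
  VERBATIM (grading `lev ≡ 0`, `L = 0`, structural clauses vacuous, `θ = 1`, `D = ((1+ε₀)²)^K`) for every
  such table and EVERY `ε₀ > 0` — a corner of BOTH registered stubs (`1/4 < ε₀ ≤ 1` and `0 < ε₀ ≤ 1/4`);
  `kpProper_ranked_primaryGraded` — the same for RANKED (feed-forward) networks: a rank `r : Fin 4 → ℕ`,
  `r < K`, strictly increasing along every feed `x_a² → x_i'` one shell up and along every in-shell
  coupling `x_a x_b → x_i'` (`a, b ≠ i`); certificate `A n = {i : n ≤ r i}`.  Example: the feed-forward
  chain `0 → 1 → 2 → 3` into a dead end (`r = id`, `K = 4`), uncovered by every landed rung (all of which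
  are recurrent: one-mode chain, permutation / fan networks, 2-cycle, side-branch class).

USE (for the LEAD's composition `ForwardTailCeilingKP_of`): on a ranked / dark-shell table,
`exact Theorems.kpProper_ranked_primaryGraded R ε₀ h0 α r K hrK hfeed hin` closes the goal
`PrimaryGradedAt R ε₀ α` by unfolding.  So inside both stubs only the RECURRENT networks (a feed or pump
cycle keeping a source lit at every shell) remain — where the open-in-print content lives.
HONEST FRAMING: statements about Tao-type MODEL lattice ODEs (route SubOnsagerCeiling, rung TL-M2Break); a
degenerate corner (the energy climbs at most `K` shells) of the registered stubs, not the stubs; nothing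
here bears on Navier–Stokes regularity and no stub, crux or summit is proved.
[cite: Tao2016AveragedNS, §4 (4.2)–(4.3), (4.13)] [cite: Teschl2012, §2.4 (Grönwall)]
-/

noncomputable section

-- the sub-problem namespace `NavierStokesRegularity.NavierStokesRegularity` is the tree's layout (D-0017)
set_option linter.dupNamespace false

namespace Summit.NavierStokesRegularity.NavierStokesRegularity.Theorems

open Set Finset
open Literature.Analysis.FluidPDE.TaoCascade

variable {α : Fin 4 → Fin 4 → Fin 4 → ℤ × ℤ × ℤ → ℝ}

/-! ## §4 The barrier for a network with a dark shell -/

/-- **THE ν-UNIFORM BARRIER FOR A KP NETWORK PROPER WITH A DARK SHELL.**  If a lit-set certificate `A` of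
the table (§3) is EMPTY at every shell `n ≥ K`, then along every honest non-negative viscous solution
(`ν ≥ 0`, `ε₀ ≥ 0`) from a one-shell datum: `(1+ε₀)^{2k}·½X_{i,k}(t)² ≤ ((1+ε₀)²)^K·Σ_j ½(X₀)_j²` for
every mode `i`, every shell `k : ℕ`, every `t ∈ [0,s]` — the weighted shell barrier with `θ = 1` and
`D = (1+ε₀)^{2K}`, uniform in `ν`, in the datum and in the window. MODEL lattice statement.
[cite: Tao2016AveragedNS, §4 (4.13)] -/
theorem kpProper_darkShell_barrier (hs : IsSymmetricCoeff α) (hc : IsCancellingCoeff α)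
    (hO : ∀ (Y : Fin 4 → ℤ → ℝ → ℝ) (τ : ℝ), (∀ (j : Fin 4) (k : ℤ), 1 ≤ k → 0 ≤ Y j k τ) →
      ∀ δ : ℝ, 0 < δ → ∀ (i : Fin 4) (n : ℤ), 1 ≤ n → Y i n τ = 0 → 0 ≤ quadTerm δ α Y i n τ)
    (hD : ∀ a b i : Fin 4, a ≠ b → α a b i (0, 0, 1) = 0)
    (hα1 : ∀ (a b i : Fin 4) (μ : ℤ × ℤ × ℤ), μ ∈ shiftSet → |α a b i μ| ≤ 1)
    {ε₀ ν s : ℝ} (hε : 0 ≤ ε₀) (hν : 0 ≤ ν) {X₀ : Fin 4 → ℝ} {X : Fin 4 → ℤ → ℝ → ℝ}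
    (hdat : ∀ (i : Fin 4) (k : ℤ), X i k 0 = if k = 0 then X₀ i else 0)
    (hvan : ∀ (i : Fin 4) (k : ℤ), k < 0 → ∀ t : ℝ, X i k t = 0)
    (hbdd : ∃ M : ℝ, ∀ (t : ℝ) (i : Fin 4) (k : ℤ), (1 + (1 + ε₀) ^ ((10 : ℝ) * k)) * |X i k t| ≤ M)
    (hXc : ∀ (i : Fin 4) (k : ℤ), Continuous (X i k))
    (hode : ∀ (i : Fin 4) (k : ℤ), ∀ t ∈ Icc (0 : ℝ) s, HasDerivWithinAt (X i k)
      (quadTerm ε₀ α X i k t - ν * (1 + ε₀) ^ ((2 : ℝ) * k) * X i k t) (Icc (0 : ℝ) s) t)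
    (hnn : ∀ t ∈ Icc (0 : ℝ) s, ∀ (i : Fin 4) (k : ℤ), 1 ≤ k → 0 ≤ X i k t)
    (A : ℕ → Finset (Fin 4)) (hA0 : ∀ i, i ∈ A 0)
    (hF : ∀ (n : ℕ) (i : Fin 4), i ∉ A (n + 1) → ∀ a ∈ A n, α a a i (0, 0, 1) = 0)
    (hPT : ∀ (n : ℕ) (i : Fin 4), i ∉ A (n + 1) → ∀ a ∈ A (n + 1), ∀ b ∈ A (n + 1), α a b i (0, 0, 0) = 0)
    (K : ℕ) (hK : ∀ n : ℕ, K ≤ n → ∀ i, i ∉ A n) :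
    ∀ t ∈ Icc (0 : ℝ) s, ∀ (i : Fin 4) (k : ℕ),
      (1 + ε₀) ^ (2 * (k : ℝ)) * ((1 / 2 : ℝ) * X i (k : ℤ) t ^ 2) ≤
        ((1 + ε₀) ^ 2) ^ K * ∑ j, (1 / 2 : ℝ) * X₀ j ^ 2 := by
  have hε' : 0 < 1 + ε₀ := by linarith
  -- the amplitude bound `|X| ≤ M`
  obtain ⟨M, hM'⟩ := hbdd
  have hM : ∀ (t : ℝ) (i : Fin 4) (k : ℤ), |X i k t| ≤ M := by
    intro t i k
    have h1 : (1 : ℝ) ≤ 1 + (1 + ε₀) ^ ((10 : ℝ) * k) := by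
      have := Real.rpow_nonneg hε'.le ((10 : ℝ) * k)
      linarith
    have h2 := hM' t i k
    have h3 : |X i k t| ≤ (1 + (1 + ε₀) ^ ((10 : ℝ) * k)) * |X i k t| :=
      le_mul_of_one_le_left (abs_nonneg _) h1
    exact h3.trans h2
  have hE0 : 0 ≤ ∑ j, (1 / 2 : ℝ) * X₀ j ^ 2 := Finset.sum_nonneg fun j _ => by positivity
  have hb1 : (1 : ℝ) ≤ (1 + ε₀) ^ 2 := by nlinarith
  intro t ht i k
  by_cases hk : K ≤ k
  · -- dark shell
    have hz : X i (k : ℤ) t = 0 :=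
      kpProper_dark_zero hs hc hO hD hα1 hε' hν hdat hXc hode hM A hA0 hF hPT k i (hK k hk i) t ht
    rw [hz]
    have : 0 ≤ ((1 + ε₀) ^ 2) ^ K * ∑ j, (1 / 2 : ℝ) * X₀ j ^ 2 := by positivity
    simpa using this
  · -- low shell: energy bound and `(1+ε₀)^{2k} ≤ (1+ε₀)^{2K}`
    have hk' : k ≤ K := (lt_of_not_ge hk).le
    have henergy := kpProper_half_sq_le_energy hs hc hO hD hε' hν hdat hvan hXc hode hnn t ht i k
    have hpow : (1 + ε₀) ^ (2 * (k : ℝ)) = ((1 + ε₀) ^ 2) ^ k := by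
      rw [← Real.rpow_natCast, ← Real.rpow_natCast, ← Real.rpow_mul hε'.le]
      norm_num
    rw [hpow]
    have hmono : ((1 + ε₀) ^ 2) ^ k ≤ ((1 + ε₀) ^ 2) ^ K := pow_le_pow_right₀ hb1 hk'
    have h0 : 0 ≤ (1 / 2 : ℝ) * X i (k : ℤ) t ^ 2 := by positivity
    calc ((1 + ε₀) ^ 2) ^ k * ((1 / 2 : ℝ) * X i (k : ℤ) t ^ 2)
        ≤ ((1 + ε₀) ^ 2) ^ K * ((1 / 2 : ℝ) * X i (k : ℤ) t ^ 2) := mul_le_mul_of_nonneg_right hmono h0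
      _ ≤ ((1 + ε₀) ^ 2) ^ K * ∑ j, (1 / 2 : ℝ) * X₀ j ^ 2 :=
          mul_le_mul_of_nonneg_left henergy (by positivity)

/-! ## §5 The primary graded barrier of the LEAD skeleton, verbatim -/

/-- **THE PRIMARY GRADED BARRIER FOR A KP NETWORK PROPER WITH A DARK SHELL, AT EVERY SCALE RATIO.**
For `ε₀ > 0` and a table with a lit-set certificate that empties from shell `K` on, the conclusion of the
LEAD skeleton's `PrimaryGradedAt R ε₀ α` (Cruxes/ForwardTailCeilingKP/Lines/kp_shell_barrier.lean, v6–v19)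
holds VERBATIM with the grading `lev ≡ 0`, `L = 0` (structural clauses vacuous), `θ = 1`,
`D = ((1+ε₀)²)^K`: a corner of BOTH registered stubs `stub_primaryGradedLargeRatio` /
`stub_primaryGradedSmallRatio` (every `ε₀ ∈ (0,1]`). MODEL lattice statement; no stub, crux or summit is
proved. [cite: Tao2016AveragedNS, §4 (4.2)–(4.3), (4.13)] -/
theorem kpProper_darkShell_primaryGraded (R ε₀ : ℝ) (hε : 0 < ε₀)
    (α : Fin 4 → Fin 4 → Fin 4 → ℤ × ℤ × ℤ → ℝ)
    (A : ℕ → Finset (Fin 4)) (hA0 : ∀ i, i ∈ A 0)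
    (hF : ∀ (n : ℕ) (i : Fin 4), i ∉ A (n + 1) → ∀ a ∈ A n, α a a i (0, 0, 1) = 0)
    (hPT : ∀ (n : ℕ) (i : Fin 4), i ∉ A (n + 1) → ∀ a ∈ A (n + 1), ∀ b ∈ A (n + 1), α a b i (0, 0, 0) = 0)
    (K : ℕ) (hK : ∀ n : ℕ, K ≤ n → ∀ i, i ∉ A n) :
    Literature.Analysis.FluidPDE.TaoCascade.InTableClass R α →
    (∀ (Y : Fin 4 → ℤ → ℝ → ℝ) (τ : ℝ), (∀ (j : Fin 4) (k : ℤ), 1 ≤ k → 0 ≤ Y j k τ) → ∀ δ : ℝ, 0 < δ →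
      ∀ (i : Fin 4) (n : ℤ), 1 ≤ n → Y i n τ = 0 → 0 ≤ Literature.Analysis.FluidPDE.TaoCascade.quadTerm δ α Y i n τ) →
    (∀ a b i : Fin 4, a ≠ b → α a b i (0, 0, 1) = 0) →
    ∃ (lev : Fin 4 → ℕ) (L : ℕ), (∀ a, lev a ≤ L) ∧
      (∀ a, lev a ≠ 0 → (∃ e, α a a e (0, 0, 1) ≠ 0) →
        (∀ j, α j j a (0, 0, 1) ≠ 0 → lev j < lev a ∧ (lev j = 0 ∨ ∃ e', α j j e' (0, 0, 1) ≠ 0)) ∧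
        (∀ i₁ i₂, i₁ ≠ a → i₂ ≠ a → α i₁ i₂ a (0, 0, 0) ≠ 0 →
          (lev i₁ < lev a ∧ (lev i₁ = 0 ∨ ∃ e', α i₁ i₁ e' (0, 0, 1) ≠ 0)) ∧
          (lev i₂ < lev a ∧ (lev i₂ = 0 ∨ ∃ e', α i₂ i₂ e' (0, 0, 1) ≠ 0))) ∧
        (∃ e, α a a e (0, 0, 1) ≠ 0 ∧
          (∀ j, α e e j (0, 0, 1) ≠ 0 → lev j < lev a ∧ (lev j = 0 ∨ ∃ e', α j j e' (0, 0, 1) ≠ 0)) ∧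
          (∀ j, j ≠ e → α e e j (0, 0, 0) ≠ 0 →
            lev j < lev a ∧ (lev j = 0 ∨ ∃ e', α j j e' (0, 0, 1) ≠ 0)))) ∧
      ∃ θ : ℝ, 1 / 2 < θ ∧ θ ≤ 1 ∧ ∃ D : ℝ, 0 ≤ D ∧
        ∀ ν : ℝ, 0 < ν → ∀ (X₀ : Fin 4 → ℝ) (s : ℝ), 0 < s → ∀ X : Fin 4 → ℤ → ℝ → ℝ,
        (∀ (i : Fin 4) (k : ℤ), X i k 0 = if k = 0 then X₀ i else 0) →
        (∀ (i : Fin 4) (k : ℤ), k < 0 → ∀ t : ℝ, X i k t = 0) →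
        (∃ M : ℝ, ∀ (t : ℝ) (i : Fin 4) (k : ℤ), (1 + (1 + ε₀) ^ ((10 : ℝ) * k)) * |X i k t| ≤ M) →
        (∀ (i : Fin 4) (k : ℤ), Continuous (X i k)) →
        (∀ (i : Fin 4) (k : ℤ), ∀ t ∈ Set.Icc (0 : ℝ) s, HasDerivWithinAt (X i k)
          (Literature.Analysis.FluidPDE.TaoCascade.quadTerm ε₀ α X i k t - ν * (1 + ε₀) ^ ((2 : ℝ) * k) * X i k t)
          (Set.Icc (0 : ℝ) s) t) →
        (∀ t ∈ Set.Icc (0 : ℝ) s, ∀ (i : Fin 4) (k : ℤ), 1 ≤ k → 0 ≤ X i k t) →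
        ∀ t ∈ Set.Icc (0 : ℝ) s, ∀ i, lev i = 0 → ∀ k : ℕ,
          (1 + ε₀) ^ (2 * θ * (k : ℝ)) * ((1 / 2 : ℝ) * X i (k : ℤ) t ^ 2) ≤
            D * (∑ j : Fin 4, (1 / 2 : ℝ) * X₀ j ^ 2) := by
  intro hT hO hD
  obtain ⟨hs, hc, hcomp⟩ := hT
  have hα1 : ∀ (a b i : Fin 4) (μ : ℤ × ℤ × ℤ), μ ∈ shiftSet → |α a b i μ| ≤ 1 :=
    fun a b i μ hμ => (hcomp a b i μ hμ).1
  refine ⟨fun _ => 0, 0, fun _ => le_rfl, fun a ha => absurd rfl ha, 1, by norm_num, le_rfl,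
    ((1 + ε₀) ^ 2) ^ K, by positivity, ?_⟩
  intro ν hν X₀ s hs' X hdat hvan hbdd hXc hode hnn t ht i _ k
  have h := kpProper_darkShell_barrier hs hc hO hD hα1 hε.le hν.le hdat hvan hbdd hXc hode hnn A hA0 hF
    hPT K hK t ht i k
  have e : (2 * (1 : ℝ) * (k : ℝ)) = 2 * (k : ℝ) := by ring
  rw [e]
  exact h

/-- **RANKED (feed-forward) KP NETWORKS PROPER SATISFY THE PRIMARY GRADED BARRIER AT EVERY SCALE RATIO.**
If a rank `r : Fin 4 → ℕ`, `r < K`, strictly increases along every feed (`α a a i (0,0,1) ≠ 0 → r a < r i`;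
in particular no mode feeds itself: no Katz–Pavlović chain, no feed cycle) and along every in-shell
coupling into a third mode (`a ≠ i`, `b ≠ i`, `α a b i (0,0,0) ≠ 0 → r a < r i`; no pump cycle), then the
lit sets `A n = {i : n ≤ r i}` are a certificate emptying at shell `K`, and `kpProper_darkShell_primaryGraded`
applies: the conclusion of `PrimaryGradedAt R ε₀ α` for every `ε₀ > 0`.  Example: the feed-forward chain
`0 → 1 → 2 → 3` into a dead end (`r = id`, `K = 4`). MODEL lattice statement; a degenerate corner (the
energy climbs at most `K` shells) of both registered stubs; no stub, crux or summit is proved.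
[cite: Tao2016AveragedNS, §4 (4.2)–(4.3), (4.13)] -/
theorem kpProper_ranked_primaryGraded (R ε₀ : ℝ) (hε : 0 < ε₀)
    (α : Fin 4 → Fin 4 → Fin 4 → ℤ × ℤ × ℤ → ℝ) (r : Fin 4 → ℕ) (K : ℕ) (hrK : ∀ i, r i < K)
    (hfeed : ∀ a i, α a a i (0, 0, 1) ≠ 0 → r a < r i)
    (hin : ∀ a b i, a ≠ i → b ≠ i → α a b i (0, 0, 0) ≠ 0 → r a < r i) :
    Literature.Analysis.FluidPDE.TaoCascade.InTableClass R α →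
    (∀ (Y : Fin 4 → ℤ → ℝ → ℝ) (τ : ℝ), (∀ (j : Fin 4) (k : ℤ), 1 ≤ k → 0 ≤ Y j k τ) → ∀ δ : ℝ, 0 < δ →
      ∀ (i : Fin 4) (n : ℤ), 1 ≤ n → Y i n τ = 0 → 0 ≤ Literature.Analysis.FluidPDE.TaoCascade.quadTerm δ α Y i n τ) →
    (∀ a b i : Fin 4, a ≠ b → α a b i (0, 0, 1) = 0) →
    ∃ (lev : Fin 4 → ℕ) (L : ℕ), (∀ a, lev a ≤ L) ∧
      (∀ a, lev a ≠ 0 → (∃ e, α a a e (0, 0, 1) ≠ 0) →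
        (∀ j, α j j a (0, 0, 1) ≠ 0 → lev j < lev a ∧ (lev j = 0 ∨ ∃ e', α j j e' (0, 0, 1) ≠ 0)) ∧
        (∀ i₁ i₂, i₁ ≠ a → i₂ ≠ a → α i₁ i₂ a (0, 0, 0) ≠ 0 →
          (lev i₁ < lev a ∧ (lev i₁ = 0 ∨ ∃ e', α i₁ i₁ e' (0, 0, 1) ≠ 0)) ∧
          (lev i₂ < lev a ∧ (lev i₂ = 0 ∨ ∃ e', α i₂ i₂ e' (0, 0, 1) ≠ 0))) ∧
        (∃ e, α a a e (0, 0, 1) ≠ 0 ∧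
          (∀ j, α e e j (0, 0, 1) ≠ 0 → lev j < lev a ∧ (lev j = 0 ∨ ∃ e', α j j e' (0, 0, 1) ≠ 0)) ∧
          (∀ j, j ≠ e → α e e j (0, 0, 0) ≠ 0 →
            lev j < lev a ∧ (lev j = 0 ∨ ∃ e', α j j e' (0, 0, 1) ≠ 0)))) ∧
      ∃ θ : ℝ, 1 / 2 < θ ∧ θ ≤ 1 ∧ ∃ D : ℝ, 0 ≤ D ∧
        ∀ ν : ℝ, 0 < ν → ∀ (X₀ : Fin 4 → ℝ) (s : ℝ), 0 < s → ∀ X : Fin 4 → ℤ → ℝ → ℝ,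
        (∀ (i : Fin 4) (k : ℤ), X i k 0 = if k = 0 then X₀ i else 0) →
        (∀ (i : Fin 4) (k : ℤ), k < 0 → ∀ t : ℝ, X i k t = 0) →
        (∃ M : ℝ, ∀ (t : ℝ) (i : Fin 4) (k : ℤ), (1 + (1 + ε₀) ^ ((10 : ℝ) * k)) * |X i k t| ≤ M) →
        (∀ (i : Fin 4) (k : ℤ), Continuous (X i k)) →
        (∀ (i : Fin 4) (k : ℤ), ∀ t ∈ Set.Icc (0 : ℝ) s, HasDerivWithinAt (X i k)
          (Literature.Analysis.FluidPDE.TaoCascade.quadTerm ε₀ α X i k t - ν * (1 + ε₀) ^ ((2 : ℝ) * k) * X i k t)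
          (Set.Icc (0 : ℝ) s) t) →
        (∀ t ∈ Set.Icc (0 : ℝ) s, ∀ (i : Fin 4) (k : ℤ), 1 ≤ k → 0 ≤ X i k t) →
        ∀ t ∈ Set.Icc (0 : ℝ) s, ∀ i, lev i = 0 → ∀ k : ℕ,
          (1 + ε₀) ^ (2 * θ * (k : ℝ)) * ((1 / 2 : ℝ) * X i (k : ℤ) t ^ 2) ≤
            D * (∑ j : Fin 4, (1 / 2 : ℝ) * X₀ j ^ 2) := by
  classical
  refine kpProper_darkShell_primaryGraded R ε₀ hε α (fun n => Finset.univ.filter fun i => n ≤ r i)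
    (fun i => by simp) ?_ ?_ K ?_
  · intro n i hi a ha
    simp only [Finset.mem_filter, Finset.mem_univ, true_and, not_le] at hi ha
    by_contra h
    have := hfeed a i h
    omega
  · intro n i hi a ha b hb
    simp only [Finset.mem_filter, Finset.mem_univ, true_and, not_le] at hi ha hb
    by_contra h
    have hai : a ≠ i := by rintro rfl; omega
    have hbi : b ≠ i := by rintro rfl; omega
    have := hin a b i hai hbi h
    omega
  · intro n hn i
    simp only [Finset.mem_filter, Finset.mem_univ, true_and, not_le]
    have := hrK i
    omega

/-! ## §6 Eventually dark modes may be taken primary (appended 2026-08-31) -/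

/-- **AN EVENTUALLY DARK MODE OBEYS THE `θ = 1` BARRIER, ν-UNIFORMLY — whatever the rest of the network
does.**  Along a lit-set certificate `A` of a KP network proper (clauses of `kpProper_dark_zero`; the network
may well be RECURRENT elsewhere), a mode `i` that is dark from shell `K` on (`i ∉ A n` for `n ≥ K`) satisfies
`(1+ε₀)^{2k}·½X_{i,k}(t)² ≤ ((1+ε₀)²)^K·Σ_j ½(X₀)_j²` for every shell `k : ℕ` and `t ∈ [0,s]` along every honest
non-negative viscous solution from a one-shell datum (`ν ≥ 0`, `ε₀ ≥ 0`).  USE: in a grading for the LEAD's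
`PrimaryGradedAt`, every eventually dark mode (dead ends and side paths of finite depth hanging off the lit
core, modes never reached) can be put at level `0` at no cost; only the modes lit at every shell — the
RECURRENT core — need a genuine barrier. MODEL lattice statement; no stub, crux or summit is proved.
[cite: Tao2016AveragedNS, §4 (4.13)] -/
theorem kpProper_eventuallyDark_barrier (hs : IsSymmetricCoeff α) (hc : IsCancellingCoeff α)
    (hO : ∀ (Y : Fin 4 → ℤ → ℝ → ℝ) (τ : ℝ), (∀ (j : Fin 4) (k : ℤ), 1 ≤ k → 0 ≤ Y j k τ) →
      ∀ δ : ℝ, 0 < δ → ∀ (i : Fin 4) (n : ℤ), 1 ≤ n → Y i n τ = 0 → 0 ≤ quadTerm δ α Y i n τ)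
    (hD : ∀ a b i : Fin 4, a ≠ b → α a b i (0, 0, 1) = 0)
    (hα1 : ∀ (a b i : Fin 4) (μ : ℤ × ℤ × ℤ), μ ∈ shiftSet → |α a b i μ| ≤ 1)
    {ε₀ ν s : ℝ} (hε : 0 ≤ ε₀) (hν : 0 ≤ ν) {X₀ : Fin 4 → ℝ} {X : Fin 4 → ℤ → ℝ → ℝ}
    (hdat : ∀ (i : Fin 4) (k : ℤ), X i k 0 = if k = 0 then X₀ i else 0)
    (hvan : ∀ (i : Fin 4) (k : ℤ), k < 0 → ∀ t : ℝ, X i k t = 0)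
    (hbdd : ∃ M : ℝ, ∀ (t : ℝ) (i : Fin 4) (k : ℤ), (1 + (1 + ε₀) ^ ((10 : ℝ) * k)) * |X i k t| ≤ M)
    (hXc : ∀ (i : Fin 4) (k : ℤ), Continuous (X i k))
    (hode : ∀ (i : Fin 4) (k : ℤ), ∀ t ∈ Icc (0 : ℝ) s, HasDerivWithinAt (X i k)
      (quadTerm ε₀ α X i k t - ν * (1 + ε₀) ^ ((2 : ℝ) * k) * X i k t) (Icc (0 : ℝ) s) t)
    (hnn : ∀ t ∈ Icc (0 : ℝ) s, ∀ (i : Fin 4) (k : ℤ), 1 ≤ k → 0 ≤ X i k t)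
    (A : ℕ → Finset (Fin 4)) (hA0 : ∀ i, i ∈ A 0)
    (hF : ∀ (n : ℕ) (i : Fin 4), i ∉ A (n + 1) → ∀ a ∈ A n, α a a i (0, 0, 1) = 0)
    (hPT : ∀ (n : ℕ) (i : Fin 4), i ∉ A (n + 1) → ∀ a ∈ A (n + 1), ∀ b ∈ A (n + 1), α a b i (0, 0, 0) = 0)
    (K : ℕ) {i : Fin 4} (hi : ∀ n : ℕ, K ≤ n → i ∉ A n) :
    ∀ t ∈ Icc (0 : ℝ) s, ∀ k : ℕ,
      (1 + ε₀) ^ (2 * (k : ℝ)) * ((1 / 2 : ℝ) * X i (k : ℤ) t ^ 2) ≤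
        ((1 + ε₀) ^ 2) ^ K * ∑ j, (1 / 2 : ℝ) * X₀ j ^ 2 := by
  have hε' : 0 < 1 + ε₀ := by linarith
  obtain ⟨M, hM'⟩ := hbdd
  have hM : ∀ (t : ℝ) (i : Fin 4) (k : ℤ), |X i k t| ≤ M := by
    intro t i k
    have h1 : (1 : ℝ) ≤ 1 + (1 + ε₀) ^ ((10 : ℝ) * k) := by
      have := Real.rpow_nonneg hε'.le ((10 : ℝ) * k)
      linarith
    exact (le_mul_of_one_le_left (abs_nonneg _) h1).trans (hM' t i k)
  have hb1 : (1 : ℝ) ≤ (1 + ε₀) ^ 2 := by nlinarith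
  intro t ht k
  by_cases hk : K ≤ k
  · have hz : X i (k : ℤ) t = 0 :=
      kpProper_dark_zero hs hc hO hD hα1 hε' hν hdat hXc hode hM A hA0 hF hPT k i (hi k hk) t ht
    rw [hz]
    have : 0 ≤ ((1 + ε₀) ^ 2) ^ K * ∑ j, (1 / 2 : ℝ) * X₀ j ^ 2 :=
      mul_nonneg (by positivity) (Finset.sum_nonneg fun j _ => by positivity)
    simpa using this
  · have hk' : k ≤ K := (lt_of_not_ge hk).le
    have henergy := kpProper_half_sq_le_energy hs hc hO hD hε' hν hdat hvan hXc hode hnn t ht i k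
    have hpow : (1 + ε₀) ^ (2 * (k : ℝ)) = ((1 + ε₀) ^ 2) ^ k := by
      rw [← Real.rpow_natCast, ← Real.rpow_natCast, ← Real.rpow_mul hε'.le]
      norm_num
    rw [hpow]
    have hmono : ((1 + ε₀) ^ 2) ^ k ≤ ((1 + ε₀) ^ 2) ^ K := pow_le_pow_right₀ hb1 hk'
    have h0 : 0 ≤ (1 / 2 : ℝ) * X i (k : ℤ) t ^ 2 := by positivity
    calc ((1 + ε₀) ^ 2) ^ k * ((1 / 2 : ℝ) * X i (k : ℤ) t ^ 2)
        ≤ ((1 + ε₀) ^ 2) ^ K * ((1 / 2 : ℝ) * X i (k : ℤ) t ^ 2) := mul_le_mul_of_nonneg_right hmono h0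
      _ ≤ ((1 + ε₀) ^ 2) ^ K * ∑ j, (1 / 2 : ℝ) * X₀ j ^ 2 :=
          mul_le_mul_of_nonneg_left henergy (by positivity)

end Summit.NavierStokesRegularity.NavierStokesRegularity.Theorems

end
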